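import Literature.NumberTheory.GaloisRepresentations.LocalWeilDatumExtensionValuation
import Literature.NumberTheory.GaloisRepresentations.LocalWeilDatumExtensionGalois
import Literature.NumberTheory.GaloisRepresentations.LocalWeilDatumRelative
import Literature.NumberTheory.GaloisRepresentations.SerreWeightExistenceProofs
import Literature.NumberTheory.GaloisRepresentations.AbsGaloisGroupOpenNormal
import Mathlib.RingTheory.Norm.Transitivity
import HarnessLib

/-!
# The Weil datum of a non-archimedean local field, XI: an inseparable `E/F` read inside `F̄`

For a finite, possibly **inseparable**, extension `E/F` of non-archimedean local fields with
`E₀ = ι⁻¹(E) ⊆ F̄` (`embField F E`), let `S₀ = E₀ ∩ F^sep` be the separable closure of `F` in `E₀`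
(`sepPart F E`, and `embSepField F E` its copy in `F̄`), and `q = [E₀ : S₀]` the inseparable degree.
This file provides what the inseparable case of the norm functoriality of the reciprocity map needs
on top of parts VIII–X:

* `galFixing F E₀s = galFixing F E₀` (`E₀/E₀s` is purely inseparable and Frobenius is injective,
  `apply_eq_self_of_forall_mem_separableClosure`), so `W_F ∩ G_{E₀} = W_F ∩ G_{E₀s}` **is a field of
  the Weil datum of `F`** even when `E/F` is inseparable (`isFieldSubgroup_fieldSubgroup_embField`);
* the relative Frobenius `z ↦ z^q : E₀ → E₀s` (`powEmb`), onto by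
  `IsNonarchimedeanLocalField.iterateFrobenius_surjective` (`SerreWeightExistenceProofs`, `[F : F^p] = p`);
* **the norm of a purely inseparable extension is the power map**:
  `algebraMap_norm_eq_pow_finrank_of_isPurelyInseparable`, whence `N_{E₀/F}(z) = N_{E₀s/F}(z^q)`.

## References

* J.-P. Serre, *Local Fields*, Ch. II §4; Ch. XIII §4 Prop. 10. [SerreLocalFields1979]
* J. S. Milne, *Fields and Galois Theory*, Ch. 3 (purely inseparable extensions). [MilneFT2022]
-/

noncomputable section

open Field IsNonarchimedeanLocalField ValuativeRel Polynomial
open scoped Pointwise Valued IntermediateField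

namespace Literature.NumberTheory.GaloisRepresentations

/-! ### The norm of a purely inseparable extension -/

section PurelyInseparableNorm

/-- **The norm of a finite purely inseparable extension is the power map `x ↦ x^{[L:K]}`**:
the minimal polynomial of `x` is `X^{p^n} - y`, so `N_{K(x)/K}(x) = (-1)^{p^n} (-y) = y = x^{p^n}` and
`N_{L/K}(x) = y^{[L : K(x)]}`. [cite: MilneFT2022, Ch. 3] -/
theorem algebraMap_norm_eq_pow_finrank_of_isPurelyInseparable {K L : Type*} [Field K] [Field L]
    [Algebra K L] [FiniteDimensional K L] [IsPurelyInseparable K L] (x : L) :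
    algebraMap K L (Algebra.norm K x) = x ^ Module.finrank K L := by
  obtain ⟨p, hp⟩ := ExpChar.exists K
  haveI := hp
  haveI : ExpChar L p := expChar_of_injective_algebraMap (algebraMap K L).injective p
  have hx : IsIntegral K x := Algebra.IsIntegral.isIntegral x
  obtain ⟨n, y, hmin⟩ := IsPurelyInseparable.minpoly_eq_X_pow_sub_C K p x
  have hpn : 0 < p ^ n := expChar_pow_pos K p n
  -- `x ^ p^n = y`
  have hxn : x ^ p ^ n = algebraMap K L y := by
    have := minpoly.aeval K x
    rw [hmin] at this
    simpa [sub_eq_zero] using this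
  -- `[K(x) : K] = p^n`
  have hdeg : (minpoly K x).natDegree = p ^ n := by
    rw [hmin, natDegree_X_pow_sub_C]
  have hfin : Module.finrank K K⟮x⟯ = p ^ n := by rw [IntermediateField.adjoin.finrank hx, hdeg]
  -- `N_{K(x)/K}(x) = y`
  have hgen : Algebra.norm K (IntermediateField.AdjoinSimple.gen K x) = y := by
    have h := Algebra.PowerBasis.norm_gen_eq_coeff_zero_minpoly (IntermediateField.adjoin.powerBasis hx)
    rw [IntermediateField.adjoin.powerBasis_gen, IntermediateField.adjoin.powerBasis_dim,
      IntermediateField.minpoly_gen, hmin, natDegree_X_pow_sub_C, neg_one_pow_expChar_pow] at h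
    rw [h, coeff_sub, coeff_X_pow, if_neg hpn.ne, coeff_C_zero, zero_sub, neg_mul_neg, one_mul]
  rw [Algebra.norm_eq_norm_adjoin K x, hgen, map_pow, ← hxn, ← pow_mul, ← hfin,
    Module.finrank_mul_finrank K K⟮x⟯ L]

end PurelyInseparableNorm

namespace LocalWeilDatum

open GaloisRepresentations.IsNonarchimedeanLocalField

section SepPart

variable (F E : Type*) [Field F] [Field E] [Algebra F E]

/-- `S₀`: the separable closure of `F` in `E₀ = ι⁻¹(E)`. [folklore] -/
abbrev sepPart : IntermediateField F (embField F E) :=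
  separableClosure F (embField F E)

/-- `E₀s ⊆ F̄`: the copy of `S₀` inside `F̄` (`E₀ ∩ F^sep`). [folklore] -/
abbrev embSepField : IntermediateField F (AlgebraicClosure F) :=
  IntermediateField.lift (sepPart F E)

/-- Membership in `E₀s`: the elements of `E₀` separable over `F`. [folklore] -/
theorem mem_embSepField_iff {a : AlgebraicClosure F} :
    a ∈ embSepField F E ↔ a ∈ embField F E ∧ IsSeparable F a := by
  constructor
  · rintro ⟨z, hz, rfl⟩
    refine ⟨z.2, ?_⟩
    have hz' : IsSeparable F z := mem_separableClosure_iff.mp hz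
    exact hz'.map (embField F E).val Subtype.val_injective
  · rintro ⟨ha, hs⟩
    refine ⟨⟨a, ha⟩, ?_, rfl⟩
    change (⟨a, ha⟩ : embField F E) ∈ separableClosure F (embField F E)
    rw [mem_separableClosure_iff]
    exact (isSeparable_map_iff (embField F E).val Subtype.val_injective).mp hs

/-- `E₀s ≤ E₀`. [folklore] -/
theorem embSepField_le_embField : embSepField F E ≤ embField F E :=
  IntermediateField.lift_le _

/-- `E₀s ⊆ F^sep`. [folklore] -/
theorem embSepField_le_sepClosure : embSepField F E ≤ sepClosure F := fun _ ha =>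
  mem_separableClosure_iff.mpr ((mem_embSepField_iff F E).mp ha).2

/-- **`Gal(F̄/E₀s) = Gal(F̄/E₀)`**: an automorphism fixing the separable part `E₀s` fixes `E₀`
(`E₀/E₀s` purely inseparable, Frobenius injective). [cite: MilneFT2022, Ch. 3] -/
theorem galFixing_embSepField_eq : galFixing F (embSepField F E) = galFixing F (embField F E) := by
  refine le_antisymm (fun σ hσ => ?_) (galFixing_antitone F (embSepField_le_embField F E))
  rw [mem_galFixing_iff]
  intro a ha
  rw [absoluteGaloisGroup.smul_def]
  refine apply_eq_self_of_forall_mem_separableClosure (embField F E) (absoluteGaloisGroup.toAlgEquiv F σ)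
    (fun y hy => ?_) a ha
  rw [← absoluteGaloisGroup.smul_def]
  exact (mem_galFixing_iff F).mp hσ y hy

variable [FiniteDimensional F E]

/-- `E₀s` is finite over `F`. [folklore] -/
theorem finiteDimensional_embSepField : FiniteDimensional F (embSepField F E) := by
  haveI := finiteDimensional_embField F E
  exact LinearEquiv.finiteDimensional (IntermediateField.liftAlgEquiv (sepPart F E)).toLinearEquiv

end SepPart

section Frob

variable (F E : Type*) [Field F] [Field E] [Algebra F E] [FiniteDimensional F E]

/-! ### The relative Frobenius `E₀ → E₀s` -/

/-- The inseparable degree `q = [E₀ : E₀s]` of `E/F` (Mathlib's `Field.finInsepDegree` of `E₀/F`,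
which equals that of `E/F`, `insepDeg_eq_finInsepDegree`). [folklore] -/
abbrev insepDeg : ℕ :=
  Field.finInsepDegree F (embField F E)

/-- `insepDeg F E` is the inseparable degree of `E/F`. [folklore] -/
theorem insepDeg_eq_finInsepDegree : insepDeg F E = Field.finInsepDegree F E :=
  (Field.finInsepDegree_eq_of_equiv F E _ (equivEmbField F E)).symm

/-- `q` is a power of the exponential characteristic. [folklore] -/
theorem insepDeg_eq_pow : ∃ m : ℕ, insepDeg F E = ringExpChar F ^ m := by
  haveI := finiteDimensional_embField F E
  exact finInsepDegree_eq_pow F (embField F E) (ringExpChar F)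

/-- `ringExpChar F ^ log (insepDeg) = insepDeg`. [folklore] -/
theorem pow_log_insepDeg : ringExpChar F ^ Nat.log (ringExpChar F) (insepDeg F E) = insepDeg F E := by
  obtain ⟨m, hm⟩ := insepDeg_eq_pow F E
  obtain ⟨p, hp⟩ := ExpChar.exists F
  have hpe : ringExpChar F = p := ringExpChar.eq F p
  rw [hm, hpe]
  rcases hp with _ | ⟨hp⟩
  · rw [one_pow, one_pow]
  · rw [Nat.log_pow hp.one_lt]

/-- `z^q ∈ E₀s` for `z ∈ E₀` (as the relative Frobenius of `SerreWeightExistenceProofs`). [folklore] -/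
theorem pow_insepDeg_mem (z : embField F E) : (z : AlgebraicClosure F) ^ insepDeg F E ∈ embSepField F E := by
  haveI := finiteDimensional_embField F E
  have h := IsPurelyInseparable.algebraMap_iterateFrobenius (sepPart F E) (ringExpChar F)
    (IsPurelyInseparable.exponent_le_log_finrank (sepPart F E) (embField F E) (ringExpChar F)) z
  -- `h : algebraMap S₀ E₀ (φ z) = z ^ p ^ log_p q`
  have h' : ((IsPurelyInseparable.iterateFrobenius (sepPart F E) (embField F E) (ringExpChar F)
      (IsPurelyInseparable.exponent_le_log_finrank (sepPart F E) (embField F E) (ringExpChar F)) z :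
        sepPart F E) : embField F E) = z ^ insepDeg F E := by
    rw [← pow_log_insepDeg F E]
    exact h
  have hmem := (IntermediateField.mem_lift (E := sepPart F E) _).mpr
    (IsPurelyInseparable.iterateFrobenius (sepPart F E) (embField F E) (ringExpChar F)
      (IsPurelyInseparable.exponent_le_log_finrank (sepPart F E) (embField F E) (ringExpChar F)) z).2
  rw [h'] at hmem
  simpa using hmem

/-- The relative Frobenius `E₀ →* E₀s`, `z ↦ z^q`, as a monoid homomorphism. [folklore] -/
def powEmb : embField F E →* embSepField F E where
  toFun z := ⟨(z : AlgebraicClosure F) ^ insepDeg F E, pow_insepDeg_mem F E z⟩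
  map_one' := Subtype.ext (by simp)
  map_mul' z z' := Subtype.ext (by simp [mul_pow])

/-- `powEmb z = z^q` in `F̄`. [folklore] -/
@[simp]
theorem coe_powEmb (z : embField F E) : ((powEmb F E z : embSepField F E) : AlgebraicClosure F) =
    (z : AlgebraicClosure F) ^ insepDeg F E :=
  rfl

/-- `0 < q`. [folklore] -/
theorem insepDeg_pos : 0 < insepDeg F E := by
  haveI := finiteDimensional_embField F E
  exact Nat.pos_of_ne_zero (NeZero.ne _)

/-- The relative Frobenius `E₀ →+* E₀s` as a ring homomorphism (`(a + b)^q = a^q + b^q`). [folklore] -/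
def powEmbRingHom : embField F E →+* embSepField F E :=
  { powEmb F E with
    map_zero' := Subtype.ext (by
      change ((0 : embField F E) : AlgebraicClosure F) ^ insepDeg F E = 0
      rw [ZeroMemClass.coe_zero, zero_pow (insepDeg_pos F E).ne'])
    map_add' := fun z z' => Subtype.ext (by
      obtain ⟨m, hm⟩ := insepDeg_eq_pow F E
      obtain ⟨p, hp⟩ := ExpChar.exists F
      haveI := hp
      have hpe : ringExpChar F = p := ringExpChar.eq F p
      haveI : ExpChar (AlgebraicClosure F) p :=
        expChar_of_injective_algebraMap (algebraMap F (AlgebraicClosure F)).injective _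
      change ((z + z' : embField F E) : AlgebraicClosure F) ^ insepDeg F E =
        (z : AlgebraicClosure F) ^ insepDeg F E + (z' : AlgebraicClosure F) ^ insepDeg F E
      rw [hm, hpe, AddMemClass.coe_add, add_pow_expChar_pow]) }

/-- `powEmbRingHom z = z^q` in `F̄`. [folklore] -/
@[simp]
theorem coe_powEmbRingHom (z : embField F E) :
    ((powEmbRingHom F E z : embSepField F E) : AlgebraicClosure F) = (z : AlgebraicClosure F) ^ insepDeg F E :=
  rfl

/-- `powEmb` is injective (Frobenius is injective). [folklore] -/
theorem powEmb_injective : Function.Injective (powEmb F E) := fun z z' h => by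
  obtain ⟨m, hm⟩ := insepDeg_eq_pow F E
  obtain ⟨p, hp⟩ := ExpChar.exists F
  haveI := hp
  have hpe : ringExpChar F = p := ringExpChar.eq F p
  haveI : ExpChar (AlgebraicClosure F) p :=
    expChar_of_injective_algebraMap (algebraMap F (AlgebraicClosure F)).injective _
  have h' := congrArg (fun u : embSepField F E => (u : AlgebraicClosure F)) h
  simp only [coe_powEmb, hm, hpe] at h'
  exact Subtype.ext (iterateFrobenius_inj (AlgebraicClosure F) p m
    (by simpa [iterateFrobenius_def] using h'))

/-- **`N_{E₀/F}(z) = N_{E₀s/F}(z^q)`**: the norm through the purely inseparable layer is the power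
map. [cite: MilneFT2022, Ch. 3] -/
theorem norm_powEmb (z : embField F E) : Algebra.norm F (powEmb F E z : embSepField F E) = Algebra.norm F z := by
  haveI := finiteDimensional_embField F E
  -- `N_{E₀/F} = N_{S₀/F} ∘ N_{E₀/S₀}` and `N_{E₀/S₀}(z) = z^q`
  have h1 : Algebra.norm F z = Algebra.norm F (Algebra.norm (sepPart F E) z) :=
    (Algebra.norm_norm (R := F) (S := sepPart F E) (a := z)).symm
  have h2 : (IntermediateField.liftAlgEquiv (sepPart F E)) (Algebra.norm (sepPart F E) z) = powEmb F E z := by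
    apply Subtype.ext
    change (((Algebra.norm (sepPart F E) z : sepPart F E) : embField F E) : AlgebraicClosure F) = (z : AlgebraicClosure F) ^ insepDeg F E
    have h3 : ((Algebra.norm (sepPart F E) z : sepPart F E) : embField F E) = z ^ insepDeg F E :=
      algebraMap_norm_eq_pow_finrank_of_isPurelyInseparable (K := sepPart F E) z
    rw [h3]
    simp
  rw [h1, ← Algebra.norm_eq_of_algEquiv (IntermediateField.liftAlgEquiv (sepPart F E)) (Algebra.norm (sepPart F E) z), h2]

end Frob

section Local

variable (F E : Type*) [Field F] [ValuativeRel F] [TopologicalSpace F] [IsNonarchimedeanLocalField F]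
  [Field E] [Algebra F E] [FiniteDimensional F E]

omit [FiniteDimensional F E] in
/-- `W_F ∩ G_{E₀s} = W_F ∩ G_{E₀}`. [folklore] -/
theorem fieldSubgroup_embSepField_eq : fieldSubgroup F (embSepField F E) = fieldSubgroup F (embField F E) := by
  ext w
  rw [← toAbsGalois_mem_galFixing_iff, ← toAbsGalois_mem_galFixing_iff, galFixing_embSepField_eq]

/-- **`W_F ∩ G_{E₀}` is a field of the Weil datum of `F`** for every finite `E/F` (separable or not):
it is the Weil subgroup of the finite separable `E₀s`. [cite: NeukirchANT1999, Ch. IV §4] -/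
theorem isFieldSubgroup_fieldSubgroup_embField : IsFieldSubgroup F (fieldSubgroup F (embField F E)) :=
  ⟨embSepField F E, finiteDimensional_embSepField F E, embSepField_le_sepClosure F E,
    (fieldSubgroup_embSepField_eq F E).symm⟩

/-- **The relative Frobenius is onto**: every element of `E₀s` is `z^q`, `z ∈ E₀`
(`IsNonarchimedeanLocalField.iterateFrobenius_surjective`: `[F : F^p] = p` for local `F`).
[cite: SerreLocalFields1979, Ch. II §4] -/
theorem exists_pow_insepDeg_eq {a : AlgebraicClosure F} (ha : a ∈ embSepField F E) :
    ∃ z : embField F E, (z : AlgebraicClosure F) ^ insepDeg F E = a := by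
  haveI := finiteDimensional_embField F E
  obtain ⟨s, hs, rfl⟩ := ha
  obtain ⟨z, hz⟩ := iterateFrobenius_surjective (ringExpChar F) (embField F E) (sepPart F E) ⟨s, hs⟩
  refine ⟨z, ?_⟩
  have h := IsPurelyInseparable.algebraMap_iterateFrobenius (sepPart F E) (ringExpChar F)
    (IsPurelyInseparable.exponent_le_log_finrank (sepPart F E) (embField F E) (ringExpChar F)) z
  rw [hz] at h
  change (algebraMap (sepPart F E) (embField F E)) ⟨s, hs⟩ =
    z ^ ringExpChar F ^ Nat.log (ringExpChar F) (insepDeg F E) at h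
  rw [pow_log_insepDeg] at h
  -- `h : algebraMap S₀ E₀ ⟨s, hs⟩ = z ^ q` in `E₀`
  have := congrArg (fun u : embField F E => (u : AlgebraicClosure F)) h
  simpa using this.symm

/-- `powEmb` is onto. [cite: SerreLocalFields1979, Ch. II §4] -/
theorem powEmb_surjective : Function.Surjective (powEmb F E) := fun a => by
  obtain ⟨z, hz⟩ := exists_pow_insepDeg_eq F E a.2
  exact ⟨z, Subtype.ext hz⟩

/-! ### Integrality and the valuation ring through the relative Frobenius -/

omit [TopologicalSpace F] [IsNonarchimedeanLocalField F] in
/-- Integrality over `𝒪[F]` is preserved and reflected by `z ↦ z^q`. [folklore] -/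
theorem isIntegral_powEmb_iff (z : embField F E) :
    IsIntegral 𝒪[F] (powEmbRingHom F E z : embSepField F E) ↔ IsIntegral 𝒪[F] z := by
  rw [← isIntegral_algHom_iff ((embSepField F E).val.restrictScalars 𝒪[F]) (fun _ _ h => Subtype.ext h),
    ← isIntegral_algHom_iff ((embField F E).val.restrictScalars 𝒪[F]) (fun _ _ h => Subtype.ext h)]
  change IsIntegral 𝒪[F] ((z : AlgebraicClosure F) ^ insepDeg F E) ↔ IsIntegral 𝒪[F] (z : AlgebraicClosure F)
  exact ⟨fun h => h.of_pow (insepDeg_pos F E), fun h => h.pow _⟩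

/-- **`O_{E₀} ≃+* O_{E₀s}` along the relative Frobenius** (a surjective, injective ring homomorphism
reflecting integrality). [cite: SerreLocalFields1979, Ch. II §4] -/
def powIntEquiv : integralClosure 𝒪[F] (embField F E) ≃+* integralClosure 𝒪[F] (embSepField F E) :=
  RingEquiv.ofBijective
    ({ toFun := fun x => ⟨powEmbRingHom F E x, (isIntegral_powEmb_iff F E _).mpr x.2⟩
       map_one' := Subtype.ext (map_one _)
       map_mul' := fun x y => Subtype.ext (map_mul _ _ _)
       map_zero' := Subtype.ext (map_zero _)
       map_add' := fun x y => Subtype.ext (map_add _ _ _) } :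
      integralClosure 𝒪[F] (embField F E) →+* integralClosure 𝒪[F] (embSepField F E))
    ⟨fun x y h => Subtype.ext (powEmb_injective F E (congrArg Subtype.val h)),
      fun y => by
        obtain ⟨z, hz⟩ := powEmb_surjective F E (y : embSepField F E)
        have hzint : IsIntegral 𝒪[F] z := (isIntegral_powEmb_iff F E z).mp
          (by rw [show powEmbRingHom F E z = powEmb F E z from rfl, hz]; exact y.2)
        exact ⟨⟨z, hzint⟩, Subtype.ext hz⟩⟩

/-- `powIntEquiv x = x^q` in `F̄`. [folklore] -/
@[simp]
theorem coe_powIntEquiv (x : integralClosure 𝒪[F] (embField F E)) :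
    (((powIntEquiv F E x : integralClosure 𝒪[F] (embSepField F E)) : embSepField F E) : AlgebraicClosure F) =
      ((x : embField F E) : AlgebraicClosure F) ^ insepDeg F E :=
  rfl

end Local

section LocalE

variable (F E : Type*) [Field F] [ValuativeRel F] [TopologicalSpace F] [IsNonarchimedeanLocalField F]
  [Field E] [ValuativeRel E] [TopologicalSpace E] [IsNonarchimedeanLocalField E]
  [Algebra F E] [FiniteDimensional F E] [ValuativeExtension F E]

/-- **`𝒪[E] ≃+* O_{E₀s}`**: the valuation ring of `E` read as the integral closure of `𝒪[F]` in the
separable `E₀s ⊆ F̄`, through `E ≅ E₀` (`integerEquiv`) and the relative Frobenius `O_{E₀} ≅ O_{E₀s}`.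
[cite: SerreLocalFields1979, Ch. II §2 Prop. 3, §4] -/
def integerSepEquiv : 𝒪[E] ≃+* integralClosure 𝒪[F] (embSepField F E) :=
  (integerEquiv F E).symm.trans (powIntEquiv F E)

/-- `integerSepEquiv x = (e x)^q` in `F̄`. [folklore] -/
theorem coe_integerSepEquiv (x : 𝒪[E]) :
    (((integerSepEquiv F E x : integralClosure 𝒪[F] (embSepField F E)) : embSepField F E) : AlgebraicClosure F) =
      ((equivEmbField F E (x : E) : embField F E) : AlgebraicClosure F) ^ insepDeg F E :=
  rfl

/-- **`q_E = q_F ^ f(E₀s)`**: the residue field of `E` is the residue field of `O_{E₀s}`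
(through `integerSepEquiv`), of cardinality `q_F ^ f`, `f` the residue degree of the separable `E₀s`.
[cite: SerreLocalFields1979, Ch. II §2, §4] -/
theorem residueFieldCard_eq_pow_inertiaDeg_sep :
    residueFieldCard E = residueFieldCard F ^ Ideal.inertiaDeg' 𝓂[F] (primeOf F (embSepField F E)) := by
  classical
  haveI := finiteDimensional_embSepField F E
  haveI := isMaximal_primeOf F (embSepField F E)
  set O := integralClosure 𝒪[F] (embSepField F E)
  have hmap : 𝓂[E] = (primeOf F (embSepField F E)).map ((integerSepEquiv F E).symm : O →+* 𝒪[E]) := by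
    have hmax : ((primeOf F (embSepField F E)).map ((integerSepEquiv F E).symm : O →+* 𝒪[E])).IsMaximal :=
      (Ideal.isMaximal_map_iff_of_bijective ((integerSepEquiv F E).symm : O →+* 𝒪[E])
        (integerSepEquiv F E).symm.bijective).mpr inferInstance
    exact (IsLocalRing.eq_maximalIdeal hmax).symm
  have e := Ideal.quotientEquiv (primeOf F (embSepField F E)) 𝓂[E] (integerSepEquiv F E).symm hmap
  rw [← card_quotient_primeOf F (embSepField F E)]
  exact (Nat.card_congr e.toEquiv).symm

/-- **`ord_F (N_{E₀s/F} ((e x)^q)) = f · ord_E x`** (`f` the residue degree of `E₀s`): the valuation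
of Neukirch's datum on the field `W_F ∩ G_{E₀} = W_F ∩ G_{E₀s}`, at the norm-image `(e x)^q` of `x`,
is `ord_E`. [cite: NeukirchANT1999, Ch. V §1; SerreLocalFields1979, Ch. II §2, §4] -/
theorem ord_norm_powEmb (x : Eˣ) :
    ord F (Algebra.norm F (powEmb F E (equivEmbField F E (x : E)) : embSepField F E)) =
      Ideal.inertiaDeg' 𝓂[F] (primeOf F (embSepField F E)) * ord E (x : E) := by
  classical
  haveI := finiteDimensional_embSepField F E
  have hKs := embSepField_le_sepClosure F E
  set f₀ := Ideal.inertiaDeg' 𝓂[F] (primeOf F (embSepField F E))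
  set Θ := integerSepEquiv F E
  -- uniformiser of `E` and its image
  obtain ⟨ϖ, hϖ⟩ := IsDiscreteValuationRing.exists_irreducible 𝒪[E]
  have hΘϖ : Irreducible (Θ ϖ) := (MulEquiv.irreducible_iff Θ).mpr hϖ
  -- key computation on `𝒪[E]`: `y = u ϖ^k`
  have key : ∀ (y : 𝒪[E]), y ≠ 0 →
      ord F (Algebra.norm F ((Θ y : integralClosure 𝒪[F] (embSepField F E)) : embSepField F E)) = f₀ * ord E (y : E) := by
    intro y hy
    obtain ⟨k, u, hk⟩ := IsDiscreteValuationRing.eq_unit_mul_pow_irreducible hy hϖ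
    have hΘ : Θ y = (Units.map (Θ : 𝒪[E] →* _) u : (integralClosure 𝒪[F] (embSepField F E))ˣ) * Θ ϖ ^ k := by
      rw [hk, map_mul, map_pow]
      rfl
    rw [ord_norm_eq_of_eq_unit_mul_pow F (embSepField F E) hKs hΘϖ hΘ]
    -- `ord_E y = k`
    have hϖ0 : ((ϖ : 𝒪[E]) : E) ≠ 0 := fun h => hϖ.ne_zero (Subtype.ext h)
    have hu0 : ((u : 𝒪[E]) : E) ≠ 0 := fun h => (Units.ne_zero u) (Subtype.ext h)
    have h1 : ord E ((ϖ : 𝒪[E]) : E) = 1 := ord_eq_one_of_irreducible E hϖ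
    have h0 : ord E ((u : 𝒪[E]) : E) = 0 :=
      (ord_eq_zero_iff E hu0).mpr ((Valuation.integer.integers (valuation E)).isUnit_iff_valuation_eq_one.mp u.isUnit)
    rw [hk]
    push_cast
    rw [ord_mul E hu0 (pow_ne_zero _ hϖ0), ord_pow E hϖ0, h0, h1]
    ring
  -- write `x = a / b` with `a, b ∈ 𝒪[E]`
  obtain ⟨a, b, hb, hab⟩ := IsFractionRing.div_surjective (A := 𝒪[E]) (x : E)
  have hb0 : b ≠ 0 := nonZeroDivisors.ne_zero hb
  have hb0' : ((b : 𝒪[E]) : E) ≠ 0 := fun h => hb0 (Subtype.ext h)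
  have ha0' : ((a : 𝒪[E]) : E) ≠ 0 := by
    intro h
    apply x.ne_zero
    rw [← hab, show algebraMap 𝒪[E] E a = (a : E) from rfl, h, zero_div]
  have ha0 : a ≠ 0 := fun h => ha0' (by rw [h]; rfl)
  -- multiplicativity: `x · b = a`
  have hxb : (x : E) * (b : E) = (a : E) := by
    rw [← hab]
    exact div_mul_cancel₀ _ hb0'
  have hmul : powEmb F E (equivEmbField F E (x : E)) * (Θ b : integralClosure 𝒪[F] (embSepField F E)) =
      (Θ a : integralClosure 𝒪[F] (embSepField F E)) := by
    apply Subtype.ext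
    simp only [MulMemClass.coe_mul, coe_powEmb, coe_integerSepEquiv, Θ]
    rw [← mul_pow, ← MulMemClass.coe_mul, ← map_mul, hxb]
  have hN : ord F (Algebra.norm F (powEmb F E (equivEmbField F E (x : E)) : embSepField F E)) +
      ord F (Algebra.norm F ((Θ b : integralClosure 𝒪[F] (embSepField F E)) : embSepField F E)) =
        ord F (Algebra.norm F ((Θ a : integralClosure 𝒪[F] (embSepField F E)) : embSepField F E)) := by
    have hn0 : ∀ {z : embSepField F E}, z ≠ 0 → Algebra.norm F z ≠ 0 := fun hz => Algebra.norm_ne_zero_iff.mpr hz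
    have hz1 : (powEmb F E (equivEmbField F E (x : E)) : embSepField F E) ≠ 0 := by
      intro h
      have := congrArg (fun z : embSepField F E => (z : AlgebraicClosure F)) h
      simp only [coe_powEmb, ZeroMemClass.coe_zero] at this
      exact (pow_ne_zero _ (fun h' => x.ne_zero ((map_eq_zero_iff _ (equivEmbField F E).injective).mp
        (Subtype.ext h')))) this
    have hz2 : ((Θ b : integralClosure 𝒪[F] (embSepField F E)) : embSepField F E) ≠ 0 := fun h =>
      hb0 ((map_eq_zero_iff Θ Θ.injective).mp (Subtype.ext h))
    rw [← ord_mul F (hn0 hz1) (hn0 hz2), ← map_mul, hmul]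
  have hE : ord E (x : E) + ord E (b : E) = ord E (a : E) := by
    rw [← ord_mul E x.ne_zero hb0', hxb]
  rw [key a ha0, key b hb0] at hN
  linear_combination hN - (f₀ : ℤ) * hE

end LocalE

end LocalWeilDatum

end Literature.NumberTheory.GaloisRepresentations
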